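import Mathlib
import Literature.NumberTheory.Transcendental.LinEDSCompact
import HarnessLib

/-!
# `KernelModuloPeriodConjecture`, line `Sketch`: bits of the XOR-fold (engine v3, C1: compaction)

Crux `FurushoPentagon.KernelModuloPeriodConjecture` (stmt-KontsevichZagierPeriods-15058), line
`Sketch`, registered stub `stub_xorFold_testBit` of the lead's skeleton (soundness of the slot
COMPACTION of the kernel-checkable GF(2) rank engine,
`Literature/NumberTheory/Transcendental/LinEDSCompact.lean`, needed in weight `16`).
`LinEDS.xorFold W f r` XOR-folds the bitset `r` into width `W`; we prove its exact bit-level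
semantics and the form the compacted block master needs:

* `xorFoldC1_testBit` — for `j < W` and `r < 2^(W(f+1))`, bit `j` of `xorFold W f r` is the
  parity of the number of set bits of `r` among the positions `j, j + W, …, j + fW` (induction on
  the fuel `f`: either `r < 2^W` already and only the position `j` can be set, or one fold step
  replaces `r` by `(r >>> W) ^^^ (r % 2^W)`, whose bit `j + tW` is bit `j + (t+1)W` of `r`, XOR
  bit `j` of `r` when `t = 0`);
* `stub_xorFold_testBit` — if the set bits of `r` lie in a list `S ∋ c` on which `i ↦ i % W`
  is injective, then bit `c % W` of the fold is bit `c` of `r` (the only position `≡ c (mod W)`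
  that can carry a set bit is `c` itself).

Everything here is elementary bit arithmetic. [folklore]
-/

namespace Summit.KontsevichZagierPeriods.FurushoPentagon.KernelModuloPeriodConjecture

open Literature.NumberTheory.Transcendental

/-- The parity bit of the numeral of a bit is the bit. [folklore] -/
theorem xorFoldC1_bodd_toNat : ∀ b : Bool, Nat.bodd b.toNat = b := by decide

/-- Four-term Boolean XOR bookkeeping: `(A ⊕ B) ⊕ (x ⊕ y) = (A ⊕ x) ⊕ (B ⊕ y)`.
[folklore] -/
theorem xorFoldC1_xor_xor_xor_comm : ∀ A B x y : Bool,
    ((A ^^ B) ^^ (x ^^ y)) = ((A ^^ x) ^^ (B ^^ y)) := by decide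

/-- **Parity is XOR-linear**: the parity of the number of set bits of `a ^^^ b` at the positions
`g 0, …, g (n-1)` is the XOR of the same parities for `a` and for `b`. [folklore] -/
theorem xorFoldC1_bodd_sum_xor (a b : ℕ) (g : ℕ → ℕ) : ∀ n : ℕ,
    Nat.bodd (∑ t ∈ Finset.range n, ((a ^^^ b).testBit (g t)).toNat) =
      (Nat.bodd (∑ t ∈ Finset.range n, (a.testBit (g t)).toNat) ^^
        Nat.bodd (∑ t ∈ Finset.range n, (b.testBit (g t)).toNat))
  | 0 => by simp
  | n + 1 => by
    rw [Finset.sum_range_succ, Finset.sum_range_succ, Finset.sum_range_succ, Nat.bodd_add,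
      Nat.bodd_add, Nat.bodd_add, xorFoldC1_bodd_sum_xor a b g n, Nat.testBit_xor,
      xorFoldC1_bodd_toNat, xorFoldC1_bodd_toNat, xorFoldC1_bodd_toNat]
    exact xorFoldC1_xor_xor_xor_comm _ _ _ _

/-- **A short number has one chunk**: for `x < 2^W`, among the positions `j, j + W, …, j + nW`
only `j` can carry a set bit of `x`. [folklore] -/
theorem xorFoldC1_sum_of_lt {W j x : ℕ} (hx : x < 2 ^ W) (n : ℕ) :
    ∑ t ∈ Finset.range (n + 1), (x.testBit (j + t * W)).toNat = (x.testBit j).toNat := by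
  rw [Finset.sum_range_succ', zero_mul, add_zero, Finset.sum_eq_zero, zero_add]
  intro t _
  rw [Nat.testBit_lt_two_pow (lt_of_lt_of_le hx (Nat.pow_le_pow_right (by norm_num)
    ((Nat.le_mul_of_pos_left W t.succ_pos).trans (Nat.le_add_left _ _))))]
  rfl

/-- **C1 semantics — bits of the XOR-fold.** For `j < W` and `r < 2^(W(f+1))`, bit `j` of
`xorFold W f r` is the parity of the number of set bits of `r` among the positions
`j, j + W, …, j + fW`. [folklore] -/
theorem xorFoldC1_testBit {W j : ℕ} (hj : j < W) : ∀ (f r : ℕ), r < 2 ^ (W * (f + 1)) →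
    (LinEDS.xorFold W f r).testBit j =
      Nat.bodd (∑ t ∈ Finset.range (f + 1), (r.testBit (j + t * W)).toNat)
  | 0, r, hr => by
    have hr' : r < 2 ^ W := by simpa using hr
    rw [LinEDS.xorFold, Nat.mod_eq_of_lt hr', xorFoldC1_sum_of_lt hr' 0, xorFoldC1_bodd_toNat]
  | f + 1, r, hr => by
    rw [LinEDS.xorFold]
    cases h : Nat.blt r (2 ^ W)
    · rw [cond_false]
      have hr' : (r >>> W) ^^^ (r % 2 ^ W) < 2 ^ (W * (f + 1)) := by
        refine Nat.xor_lt_two_pow ?_ ((Nat.mod_lt r (Nat.two_pow_pos W)).trans_le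
          (Nat.pow_le_pow_right (by norm_num) (Nat.le_mul_of_pos_right W f.succ_pos)))
        rw [Nat.shiftRight_eq_div_pow, Nat.div_lt_iff_lt_mul (Nat.two_pow_pos W), ← pow_add]
        rwa [Nat.mul_add_one] at hr
      rw [xorFoldC1_testBit hj f _ hr', xorFoldC1_bodd_sum_xor,
        xorFoldC1_sum_of_lt (Nat.mod_lt r (Nat.two_pow_pos W)) f, xorFoldC1_bodd_toNat,
        Nat.testBit_mod_two_pow, Finset.sum_range_succ' _ (f + 1), Nat.bodd_add, zero_mul,
        add_zero, xorFoldC1_bodd_toNat]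
      have e : ∀ t, j + (t + 1) * W = W + (j + t * W) := fun t => by ring
      simp only [Nat.testBit_shiftRight, hj, decide_true, Bool.true_and, e]
    · rw [cond_true]
      have hr' : r < 2 ^ W := by simpa only [Nat.blt_eq] using h
      rw [xorFoldC1_sum_of_lt hr' (f + 1), xorFoldC1_bodd_toNat]

/-- **C1 — slot compaction is sound on injective residues** (registered stub
`stub_xorFold_testBit` of the lead's skeleton, crux stmt-KontsevichZagierPeriods-15058, line
`Sketch`). If `0 < W`, `r < 2^(W(f+1))`, every set bit of `r` lies in the list `S`, `c ∈ S`, and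
`i ↦ i % W` is injective on `S`, then bit `c % W` of `xorFold W f r` is bit `c` of `r`: folding
the row into width `W` merely relabels the column `c` as `c % W`. [folklore] -/
theorem stub_xorFold_testBit :
    ∀ (W f r c : ℕ) (S : List ℕ), 0 < W → r < 2 ^ (W * (f + 1)) →
    (∀ i, r.testBit i = true → i ∈ S) → c ∈ S →
    (∀ a ∈ S, ∀ b ∈ S, a % W = b % W → a = b) →
    (LinEDS.xorFold W f r).testBit (c % W) = r.testBit c := by
  intro W f r c S hW hr hS hc hinj
  have hcw : c % W + c / W * W = c := Nat.mod_add_div' c W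
  -- the only chunk index `t` at which the position `c % W + tW` can carry a set bit is `c / W`
  have key : ∀ t, r.testBit (c % W + t * W) = true → t = c / W := fun t ht =>
    Nat.eq_of_mul_eq_mul_right hW (Nat.add_left_cancel ((hinj _ (hS _ ht) c hc
      (by rw [Nat.add_mul_mod_self_right, Nat.mod_mod])).trans hcw.symm))
  rw [xorFoldC1_testBit (Nat.mod_lt c hW) f r hr, Finset.sum_eq_single (c / W), hcw,
    xorFoldC1_bodd_toNat]
  · intro t _ ht
    cases hb : r.testBit (c % W + t * W)
    · rfl
    · exact absurd (key t hb) ht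
  · intro hcf
    rw [Finset.mem_range, not_lt, Nat.le_div_iff_mul_le hW] at hcf
    rw [hcw, Nat.testBit_lt_two_pow (lt_of_lt_of_le hr
      (Nat.pow_le_pow_right (by norm_num) (by rwa [Nat.mul_comm] at hcf)))]
    rfl

end Summit.KontsevichZagierPeriods.FurushoPentagon.KernelModuloPeriodConjecture
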